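import Summits.Parity.GeneralizedHardyLittlewood.Theorems.LZZCertificateReplayUnconditionalLeaf
import Literature.NumberTheory.LFunctions.ZeroFreeRegionUpTo
import Literature.NumberTheory.LFunctions.LOneLowerBoundNonExceptional
import Literature.NumberTheory.LFunctions.NonExceptionalModuliPNT
import Literature.NumberTheory.LFunctions.ExplicitPNTNonExceptionalModuli
import Literature.NumberTheory.LFunctions.ExplicitLeastPrimeNonExceptionalModuli
import Literature.NumberTheory.LFunctions.LeastPrimeQuasiPolynomial
import Literature.NumberTheory.LFunctions.IllusoryHypothesesExcludedUpTo
import Literature.NumberTheory.LFunctions.ClassGroupLFunctionNoExceptionalZeroUpTo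

/-!
# Route `LZZCertificateReplay` — what the UNCONDITIONAL kernel leaf gives the consumers

`LZZCertificateReplayConsumers.lean` recorded the consumers of the rung leaf `NoExceptionalZeroUpTo 400000 (1/5)`
modulo the printed Theorem 2.1 (`theorem21`). With the leaf now unconditional
(`noExceptionalZeroUpTo_4e5_fifth`, file `LZZCertificateReplayUnconditionalLeaf.lean`: kernel replay + the
global partial-fraction inequality with the partner zero), the same consumers hold with `theorem21` struck from
their trust base. Those still carrying a named fact say so in the name (`_of`): McCurley's Theorem 1
(`McCurley1984_theorem1`) for the exception-free region, BMOR Lemma 6.12 (`lemma612_psi` / `lemma612_theta`)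
for the explicit `ψ` / least-prime bounds. UNCONDITIONAL (standard axioms, no named fact):
`kernel_lfunction_one_re_ge` (explicit `κ/log q ≤ Re L(1,χ)`, `3 ≤ q ≤ 4·10⁵`), `kernel_chebyshevPsiMod_bound`
(Page–Siegel–Walfisz with ABSOLUTE constants for all `q ≤ 4·10⁵`), `kernel_not_isSiegelZero` (no Siegel zero of
any quality `η ≥ 10` at conductors `3 ≤ q ≤ 4·10⁵`), `kernel_one_sub_realZero_ge` (effective repulsion
`(1/5)/T ≤ 1 − β` for `T ≥ max(1, log q)`). In print all of these ranges rest on Platt's numerical verification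
of GRH to height `10⁸/q`; here their trust base is the Lean kernel. No Parity credit (cell rule H5).
-/

namespace Summit.Parity.GeneralizedHardyLittlewood.Theorems

open Literature.NumberTheory.LFunctions
open Literature.NumberTheory.LFunctions.Siegel Literature.NumberTheory.LFunctions.Estermann
open Literature.Barriers.Parity

/-- **Exception-free McCurley region up to `4·10⁵`, modulo ONLY McCurley's Theorem 1**:
`ZeroFreeRegionUpTo 400000 9.645908801 10`. -/
theorem kernel_zeroFreeRegionUpTo_of (hM : McCurley1984_theorem1) : ZeroFreeRegionUpTo 400000 9.645908801 10 :=
  zeroFreeRegionUpTo_of_noExceptionalZeroUpTo hM (by norm_num) noExceptionalZeroUpTo_4e5_fifth le_rfl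
    (by norm_num) (by norm_num)

/-- **Corollary-1.2 shape up to `4·10⁵`, modulo ONLY McCurley's Theorem 1**: for every modulus
`3 ≤ q ≤ 4·10⁵`, every `χ` mod `q` and every `s ≠ 1` with `Re s ≥ 1 − 1/(10 log max(q, q|Im s|, 10))`,
`L(s, χ) ≠ 0`. -/
theorem kernel_corollary12_of (hM : McCurley1984_theorem1) {q : ℕ} [NeZero q] (hq3 : 3 ≤ q)
    (hqQ : q ≤ 400000) (χ : DirichletCharacter ℂ q) {s : ℂ} (hs : s ≠ 1)
    (hr : 1 - 1 / (10 * Real.log (max (max (q : ℝ) ((q : ℝ) * |s.im|)) 10)) ≤ s.re) :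
    χ.LFunction s ≠ 0 := by
  have hZ := kernel_zeroFreeRegionUpTo_of hM
  refine hZ q hq3 hqQ χ s hs (lt_of_lt_of_le ?_ hr)
  have hM10 : (10 : ℝ) ≤ max (max (q : ℝ) ((q : ℝ) * |s.im|)) 10 := le_max_right _ _
  have hlogM : 0 < Real.log (max (max (q : ℝ) ((q : ℝ) * |s.im|)) 10) :=
    Real.log_pos (by linarith)
  have h1 : 1 / (10 * Real.log (max (max (q : ℝ) ((q : ℝ) * |s.im|)) 10)) <
      1 / (9.645908801 * Real.log (max (max (q : ℝ) ((q : ℝ) * |s.im|)) 10)) := by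
    apply one_div_lt_one_div_of_lt
    · positivity
    · nlinarith
  linarith

/-- **`L(1, χ)` lower bound up to `4·10⁵`, UNCONDITIONAL**: for every quadratic `χ ≠ χ₀` mod `3 ≤ q ≤ 4·10⁵`,
`estermannC · (1/5) · exp(−estermannA · (1/5) · (1 + log ballConst)) / log q ≤ Re L(1, χ)`. -/
theorem kernel_lfunction_one_re_ge {q : ℕ} [NeZero q] (hq3 : 3 ≤ q) (hqQ : q ≤ 400000)
    (χ : DirichletCharacter ℂ q) (hquad : χ.IsQuadratic) (hχ : χ ≠ 1) :
    estermannC * min (1 / 5 : ℝ) (1 / 4) *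
        Real.exp (-(estermannA * min (1 / 5 : ℝ) (1 / 4) * (1 + Real.log ballConst))) / Real.log q ≤
      (χ.LFunction 1).re :=
  NoExceptionalZeroUpTo.lfunction_one_re_ge noExceptionalZeroUpTo_4e5_fifth (by norm_num) hq3 hqQ χ hquad hχ

/-- **Page–Siegel–Walfisz for all `q ≤ 4·10⁵` with absolute constants, UNCONDITIONAL**: there are `k, m > 0`
with `|ψ(x; q, a) − x/φ(q)| ≤ k · (q (1 + log q)⁵/φ(q)) · x · exp(−m √(log x)/(1 + log q))` for every
`1 ≤ q ≤ 4·10⁵`, every unit `a` mod `q`, every `x ≥ 2` — no exceptional modulus, no Siegel constant. -/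
theorem kernel_chebyshevPsiMod_bound :
    ∃ k m : ℝ, 0 < k ∧ 0 < m ∧ ∀ q : ℕ, 1 ≤ q → q ≤ 400000 → ∀ (a : (ZMod q)ˣ) (x : ℝ), 2 ≤ x →
      |Literature.NumberTheory.Sieve.ParityWave0.chebyshevPsiMod q a x - x / q.totient| ≤
        k * ((q : ℝ) * (1 + Real.log q) ^ 5 / q.totient) * x *
          Real.exp (-(m * Real.sqrt (Real.log x) / (1 + Real.log q))) := by
  obtain ⟨k, m, hk, hm, h⟩ := chebyshevPsiMod_bound_of_noExceptionalZeroUpTo (c₀ := 1 / 5) (by norm_num)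
  exact ⟨k, m, hk, hm, h 400000 noExceptionalZeroUpTo_4e5_fifth⟩

/-- **Explicit `ψ(x; q, a)` bound for `10⁵ ≤ q ≤ 4·10⁵`, modulo ONLY BMOR Lemma 6.12**:
`|ψ(x; q, a) − x/φ(q)| ≤ 1.4579 · x · √(log x/R₁) · exp(−√(log x/R₁))` for `x ≥ exp(4R₁ log² q)`. -/
theorem kernel_psi_bound_of (h612 : BMOR2018.lemma612_psi) {q : ℕ} [NeZero q] (hq : 10 ^ 5 ≤ q)
    (hqQ : q ≤ 400000) (a : (ZMod q)ˣ) {x : ℝ} (hx : Real.exp (4 * BMOR2018.R₁ * Real.log q ^ 2) ≤ x) :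
    |Literature.NumberTheory.Sieve.ParityWave0.chebyshevPsiMod q a x - x / q.totient| ≤
      BMOR2018.errTerm x :=
  BMOR2018.psi_bound_of_noExceptionalZeroUpTo h612 noExceptionalZeroUpTo_4e5_fifth
    (by unfold BMOR2018.R₁; norm_num) hq hqQ a hx

/-- **Least prime in a progression for `10⁵ ≤ q ≤ 4·10⁵`, modulo ONLY BMOR Lemma 6.12 (θ form)**: every
reduced class `a` mod `q` contains a prime `p ≤ exp(max(4R₁ log² q, √q))`. -/
theorem kernel_exists_prime_le_of (h612 : BMOR2018.lemma612_theta) {q : ℕ} [NeZero q] (hq : 10 ^ 5 ≤ q)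
    (hqQ : q ≤ 400000) (a : (ZMod q)ˣ) :
    ∃ p : ℕ, p.Prime ∧ (p : ZMod q) = a ∧
      (p : ℝ) ≤ Real.exp (max (4 * BMOR2018.R₁ * Real.log q ^ 2) (Real.sqrt q)) :=
  BMOR2018.exists_prime_le_of_noExceptionalZeroUpTo h612 noExceptionalZeroUpTo_4e5_fifth
    (by unfold BMOR2018.R₁; norm_num) hq hqQ a

/-- **C3a up to `4·10⁵`, modulo ONLY BMOR Lemma 6.12 (ψ form)**: `LeastPrimeQuasiPolyUpTo 400000` — for every
`10⁵ ≤ q ≤ 4·10⁵` and every unit `a` mod `q` a prime `p ≡ a (mod q)` with `p ≤ exp(4R₁ log² q)`. -/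
theorem kernel_leastPrimeQuasiPolyUpTo_of (h612 : BMOR2018.lemma612_psi) :
    BMOR2018.LeastPrimeQuasiPolyUpTo 400000 :=
  BMOR2018.leastPrime_of_noExceptionalZeroUpTo h612 noExceptionalZeroUpTo_4e5_fifth
    (by unfold BMOR2018.R₁; norm_num)

/-- **No Siegel zero of any quality at conductors `3 ≤ q ≤ 4·10⁵`, UNCONDITIONAL**: for every `χ` mod `q`
and every `η`, `¬ IsSiegelZero χ η` (quality `η ≥ 10` by definition; the table has width `1/5 ≥ 1/10`). -/
theorem kernel_not_isSiegelZero {q : ℕ} [NeZero q] (hq3 : 3 ≤ q) (hqQ : q ≤ 400000)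
    (χ : DirichletCharacter ℂ q) (η : ℝ) : ¬ IsSiegelZero χ η :=
  not_isSiegelZero_of_noExceptionalZeroUpTo noExceptionalZeroUpTo_4e5_fifth (by norm_num) hq3 hqQ χ η

/-- **Effective repulsion of real zeros up to `4·10⁵`, UNCONDITIONAL** (the form the Landau–Page machinery
consumes): for `q ≤ 4·10⁵`, `T ≥ 1` with `log q ≤ T`, every quadratic `χ ≠ χ₀` mod `q` and every real zero
`β` of `L(s, χ)`, `(1/5)/T ≤ 1 − β`. -/
theorem kernel_one_sub_realZero_ge {q : ℕ} [NeZero q] (hqQ : q ≤ 400000) {T : ℝ} (hT1 : 1 ≤ T)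
    (hTq : Real.log q ≤ T) (χ : DirichletCharacter ℂ q) (hquad : χ.IsQuadratic) (hχ : χ ≠ 1) {β : ℝ}
    (hβ : χ.LFunction β = 0) : (1 / 5 : ℝ) / T ≤ 1 - β := by
  have h := NoExceptionalZeroUpTo.one_sub_realZero_ge noExceptionalZeroUpTo_4e5_fifth (by norm_num) hqQ
    hT1 hTq χ hquad hχ hβ
  rwa [min_eq_left (by norm_num : (1 / 5 : ℝ) ≤ 1)] at h


/-! ## Appendix (append-only, 2026-08-26): consumer C4 — Stark descent, UNCONDITIONAL for `|d_K| ≤ 4·10⁵` -/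

/-- **No exceptional zero of any real class group `L`-function of any number field with `|d_K| ≤ 4·10⁵`,
UNCONDITIONAL (consumer C4, Stark descent)**: for every number field `K` of degree `n > 1` with
`|d_K| ≤ 4·10⁵`, every real class group character `χ` (`χ² = 1`, `ζ_K` included) and every real `σ` with
`1 − (1/5)/(8·(2n)!·log|d_K|) ≤ σ < 1`, `L(σ, χ) ≠ 0` (a zero there descends to a primitive quadratic
Dirichlet `L(σ, κ)`, conductor `3 ≤ M ≤ |d_K| ≤ 4·10⁵`, inside the kernel leaf's window). -/
theorem kernel_classGroupLFunction_ne_zero (K : Type) [Field K] [NumberField K]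
    (hK : 1 < Module.finrank ℚ K) (hdQ : (NumberField.discr K).natAbs ≤ 400000)
    (χ : ClassGroup (NumberField.RingOfIntegers K) →* ℂˣ) (hχ : χ * χ = 1) {σ : ℝ}
    (hσ : 1 - min (1 / 5 : ℝ) 1 / (8 * ((2 * Module.finrank ℚ K).factorial : ℝ) *
      Real.log ((NumberField.discr K).natAbs : ℝ)) ≤ σ)
    (hσ1 : σ < 1) : Literature.NumberTheory.LFunctions.NumberField.classGroupLFunction K χ σ ≠ 0 :=
  Literature.NumberTheory.LFunctions.NumberField.classGroupLFunction_ne_zero_of_noExceptionalZeroUpTo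
    noExceptionalZeroUpTo_4e5_fifth (by norm_num) K hK hdQ χ hχ hσ hσ1

/-- **No exceptional zero of `ζ_K` for any number field with `|d_K| ≤ 4·10⁵`, UNCONDITIONAL**: for `K` of
degree `n > 1` with `|d_K| ≤ 4·10⁵` and `1 − (1/5)/(8·(2n)!·log|d_K|) ≤ σ < 1`, `ζ_K(σ) ≠ 0`. -/
theorem kernel_dedekindZeta_ne_zero (K : Type) [Field K] [NumberField K]
    (hK : 1 < Module.finrank ℚ K) (hdQ : (NumberField.discr K).natAbs ≤ 400000) {σ : ℝ}
    (hσ : 1 - min (1 / 5 : ℝ) 1 / (8 * ((2 * Module.finrank ℚ K).factorial : ℝ) *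
      Real.log ((NumberField.discr K).natAbs : ℝ)) ≤ σ)
    (hσ1 : σ < 1) : Literature.NumberTheory.LFunctions.dedekindZetaCont K σ ≠ 0 :=
  Literature.NumberTheory.LFunctions.NumberField.dedekindZetaCont_ne_zero_of_noExceptionalZeroUpTo
    noExceptionalZeroUpTo_4e5_fifth (by norm_num) K hK hdQ hσ hσ1

end Summit.Parity.GeneralizedHardyLittlewood.Theorems


/-! ## Appendix II (append-only, 2026-08-26): consumer C4′ — the QUADRATIC-SUBFIELD form, UNCONDITIONAL

Stark's Theorem 3 in located form (`exists_quadratic_dedekindZetaCont_eq_zero`) sends a real zero of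
`ζ_K` in `[1 − 1/(4·n!·log|d_K|), 1)` to a zero of `ζ_k = ζ·L(·, χ_{d_k})` for a quadratic subfield
`k ⊆ K`, `|d_k| ≤ |d_K|`; the kernel leaf `noExceptionalZeroUpTo_4e5_fifth` (width `1/5 ≥ 1/(4·n!)` for
every `n ≥ 2`) excludes it whenever `|d_k| ≤ 4·10⁵`. So: for fields WITHOUT quadratic subfield this is
Stark's theorem (no table needed; linnik-cubic's Siegel-free regime); for fields WITH quadratic
subfields ALL of conductor `≤ 4·10⁵` — e.g. any `K` whose quadratic subfields are among
`ℚ(i), ℚ(√−3), ℚ(√±2), ℚ(√5), …` — the same window is now zero-free UNCONDITIONALLY, whatever `|d_K|` is.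
-/

namespace Summit.Parity.GeneralizedHardyLittlewood.Theorems

open Literature.NumberTheory.LFunctions Literature.NumberTheory.LFunctions.NumberField

/-- `1/(4·n!) ≤ 1/5` for the degree `n ≥ 2` of a number field (`n! ≥ 2`). -/
private theorem inv_four_factorial_le_fifth (K : Type) [Field K] [NumberField K]
    (hK : 1 < Module.finrank ℚ K) : 1 / (4 * ((Module.finrank ℚ K).factorial : ℝ)) ≤ 1 / 5 := by
  have h2 : (2 : ℝ) ≤ ((Module.finrank ℚ K).factorial : ℝ) := by
    have h := Nat.factorial_le (Nat.succ_le_of_lt hK)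
    rw [Nat.factorial_two] at h
    exact_mod_cast h
  rw [div_le_div_iff₀ (by positivity) (by norm_num)]
  linarith

/-- **Stark's window is zero-free for every number field whose quadratic subfields have conductor
`≤ 4·10⁵`, UNCONDITIONAL (consumer C4′)**: for every number field `K` of degree `n > 1` ALL OF WHOSE
QUADRATIC SUBFIELDS `k ⊆ K` have `|d_k| ≤ 4·10⁵` (no condition on `|d_K|`; vacuous hypothesis when `K`
has no quadratic subfield) and every real `σ` with `1 − 1/(4·n!·log|d_K|) ≤ σ < 1`, `ζ_K(σ) ≠ 0`. -/
theorem kernel_dedekindZeta_ne_zero_of_quadraticSubfields (K : Type) [Field K] [NumberField K]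
    (hK : 1 < Module.finrank ℚ K)
    (hQ : ∀ k : IntermediateField ℚ K, Module.finrank ℚ k = 2 →
      (NumberField.discr k).natAbs ≤ 400000)
    {σ : ℝ} (hσ : 1 - 1 / (4 * ((Module.finrank ℚ K).factorial : ℝ) *
      Real.log ((NumberField.discr K).natAbs : ℝ)) ≤ σ)
    (hσ1 : σ < 1) : Literature.NumberTheory.LFunctions.dedekindZetaCont K σ ≠ 0 :=
  dedekindZetaCont_ne_zero_starkWindow_of_noExceptionalZeroUpTo noExceptionalZeroUpTo_4e5_fifth K hK
    (inv_four_factorial_le_fifth K hK) hQ hσ hσ1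

/-- **Stark's WHOLE window is zero-free for every number field with `|d_K| ≤ 4·10⁵`, UNCONDITIONAL**
(sharpens the window `(1/5)/(8·(2n)!·log|d_K|)` of `kernel_dedekindZeta_ne_zero` to
`1/(4·n!·log|d_K|)`): for `K` of degree `n > 1` with `|d_K| ≤ 4·10⁵` and
`1 − 1/(4·n!·log|d_K|) ≤ σ < 1`, `ζ_K(σ) ≠ 0`. -/
theorem kernel_dedekindZeta_ne_zero_starkWindow (K : Type) [Field K] [NumberField K]
    (hK : 1 < Module.finrank ℚ K) (hdQ : (NumberField.discr K).natAbs ≤ 400000)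
    {σ : ℝ} (hσ : 1 - 1 / (4 * ((Module.finrank ℚ K).factorial : ℝ) *
      Real.log ((NumberField.discr K).natAbs : ℝ)) ≤ σ)
    (hσ1 : σ < 1) : Literature.NumberTheory.LFunctions.dedekindZetaCont K σ ≠ 0 :=
  kernel_dedekindZeta_ne_zero_of_quadraticSubfields K hK
    (fun k _ ↦ (natAbs_discr_le_of_algebra k K).trans hdQ) hσ hσ1

/-- **No real zero near `1` of any quadratic Dedekind zeta function of conductor `≤ 4·10⁵`,
UNCONDITIONAL**: for every quadratic number field `k` with `|d_k| ≤ 4·10⁵` and every real `σ` with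
`1 − 1/(5·log|d_k|) ≤ σ`, `0 < σ < 1`: `ζ_k(σ) ≠ 0`. -/
theorem kernel_dedekindZeta_quadratic_ne_zero (k : Type) [Field k] [NumberField k]
    (h2 : Module.finrank ℚ k = 2) (hkQ : (NumberField.discr k).natAbs ≤ 400000) {σ : ℝ}
    (hσ : 1 - (1 / 5 : ℝ) / Real.log ((NumberField.discr k).natAbs : ℝ) ≤ σ) (hσ0 : 0 < σ)
    (hσ1 : σ < 1) : Literature.NumberTheory.LFunctions.dedekindZetaCont k σ ≠ 0 :=
  dedekindZetaCont_quadratic_ne_zero_of_noExceptionalZeroUpTo noExceptionalZeroUpTo_4e5_fifth k h2 hkQ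
    hσ hσ0 hσ1

end Summit.Parity.GeneralizedHardyLittlewood.Theorems
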